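import Literature.NumberTheory.LFunctions.JensenHermiteInversion
import HarnessLib

/-!
# GORTTW's Hermite normalisation of the Jensen polynomials: the uniformizer `Δ`, `J̃^{d,n}`, Lemma 2.2 and Lemma 2.4 (GORTTW 2022, §2.1–2.2) — proved

Topic `Literature/NumberTheory/LFunctions`; third file of the Turán-criterion package
(`JensenTuranCriterion.lean`: Turán's criterion; `JensenHermiteInversion.lean`: inversion formula
and the coefficients (2.7)). Here, AS PRINTED in Griffin–Ono–Rolen–Thorner–Tripp–Wagner
[GriffinEtAl2022, §2.1–2.2], for a positive sequence `γ`: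

* (2.3) the uniformizer `Δ(M) := √(½(1 - γ(M-2)γ(M)/γ(M-1)²))` — `gorttwDelta γ M`;
* (2.6) `J̃^{d,n}(X) := γ(n+d)^{d-1}/(γ(n+d-1)^d Δ(n+d)^d) · J^{d,n}(γ(n+d-1)/γ(n+d) · (Δ(n+d)X - 1))
  = ∑_{k=0}^{d} A_{d,k}(n) X^{d-k}` — `gorttwJ γ d n`, `gorttwA γ d n k := [X^{d-k}] J̃^{d,n}`,
  `gorttwJ_eq_sum`;
* **Lemma 2.2**: `A_{d,0}(n) = 1`, `A_{d,1}(n) = 0`, `A_{d,2}(n) = -d(d-1)` — `gorttwA_zero`,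
  `gorttwA_one`, `gorttwA_two` (hypotheses: `γ > 0` and strict log-concavity
  `γ(n+d-2)γ(n+d) < γ(n+d-1)²` at `M = n+d`, which is what makes `Δ(n+d)` real and nonzero; for
  `γ = ξ`'s Taylor coefficients this is the Turán inequality of Csordas–Norfolk–Varga, in the tree
  as `WangYang2024.xiTaylorCoeff_mul_lt_sq`);
* **Lemma 2.4** verbatim: with `c_{d,n,j} := ∑_{i≤j/2} (d-j+2i)!/(i!(d-j)!) A_{d,j-2i}(n)` (2.7)
  (`= monomialToHermite d (gorttwA γ d n) j`), *if `∑_{j=3}^{d} 2^{-j}(d-j)!/(d-1)! c_{d,n,j}² < 1`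
  then `J^{d,n}(X)` is hyperbolic* — `jensenPoly_splits_of_turanSum_lt_one`, in the strong form
  `jensenPoly_eq_prod_of_turanSum_lt_one`: `J^{d,n} = γ(n+d) ∏_{i<d} (X - sᵢ)`, `s₀ < ⋯ < s_{d-1}`.
  The printed proof's first sentence ("there exist `A, B, C ∈ ℝ` … such that
  `J̃^{d,n}(X) = A J^{d,n}(BX + C)`, hence `J^{d,n}` is hyperbolic iff `J̃^{d,n}` is") is
  `jensenPoly_eq_C_mul_gorttwJ_comp` here.

* (2.8) MULTIPLIED OUT, for certificates: `A_{d,k}(n) = Δ(n+d)^{-k} B_{d,k}(n)` with `B_{d,k}(n)`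
  rational in the `γ`'s (`gorttwB`, `gorttwA_mul_gorttwDelta_pow`), `Δ(n+d)^j c_{d,n,j}` polynomial in
  `Δ² = gorttwD` and the `B`'s (`monomialToHermite_gorttwA_mul_pow`), hence the left side of (2.8) is
  the rational function `gorttwTuranRat γ d n` of `γ(n), …, γ(n+d)` — no square root —
  (`turanSum_eq_gorttwTuranRat`), and Lemma 2.4 reads `gorttwTuranRat γ d n < 1 ⇒ J^{d,n}` has `d`
  simple real zeros (`jensenPoly_eq_prod_of_gorttwTuranRat_lt_one`).

Everything is a theorem (no named facts); valid for any positive sequence `γ`, in particular for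
`γ = xiTaylorCoeff`. Not here: Theorems 2.1/2.3 of [GriffinEtAl2022] (the asymptotics of `Δ(M)`
and of `A_{d,k}(n)`), which are the analytic input the JENSEN-d certificates replace by interval data.

## References
* [GriffinEtAl2022] Griffin–Ono–Rolen–Thorner–Tripp–Wagner, Adv. Math. 397 (2022) 108186 =
  arXiv:1910.01227v3, §2.1 (2.3), (2.6), Lemma 2.2; §2.2 Lemma 2.4 with (2.5), (2.7), (2.8).
-/

noncomputable section

open Polynomial Finset
open scoped Nat

namespace Literature.NumberTheory.LFunctions

/-! ### The uniformizer and the normalised Jensen polynomial -/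

/-- GORTTW's uniformizer `Δ(M) := √(½ (1 - γ(M-2) γ(M)/γ(M-1)²))` of a sequence `γ`
[GriffinEtAl2022, (2.3)]; real and positive as soon as `γ(M-2)γ(M) < γ(M-1)²` ("a consequence of
the hyperbolicity of `J^{2,n}`", ibid.). [cite: GriffinEtAl2022, (2.3)] -/
def gorttwDelta (γ : ℕ → ℝ) (M : ℕ) : ℝ :=
  Real.sqrt ((1 - γ (M - 2) * γ M / γ (M - 1) ^ 2) / 2)

/-- GORTTW's normalised Jensen polynomial
`J̃^{d,n}(X) := γ(n+d)^{d-1}/(γ(n+d-1)^d Δ(n+d)^d) · J^{d,n}(γ(n+d-1)/γ(n+d) · (Δ(n+d) X - 1))`.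
[cite: GriffinEtAl2022, (2.6)] -/
def gorttwJ (γ : ℕ → ℝ) (d n : ℕ) : ℝ[X] :=
  C (γ (n + d) ^ (d - 1) / (γ (n + d - 1) ^ d * gorttwDelta γ (n + d) ^ d)) *
    (jensenPoly γ d n).comp (C (γ (n + d - 1) / γ (n + d)) * (C (gorttwDelta γ (n + d)) * X - 1))

/-- The coefficients `A_{d,k}(n) := [X^{d-k}] J̃^{d,n}(X)` of [GriffinEtAl2022, (2.6)].
[cite: GriffinEtAl2022, (2.6)] -/
def gorttwA (γ : ℕ → ℝ) (d n k : ℕ) : ℝ := (gorttwJ γ d n).coeff (d - k)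

section

variable {γ : ℕ → ℝ} {d n : ℕ}

/-- The inner affine map, multiplied out. [folklore] -/
private lemma inner_eq (a Δ : ℝ) :
    C a * (C Δ * X - 1) = C (a * Δ) * X - C a := by
  rw [C_mul]; ring

/-- `deg J̃^{d,n} ≤ d`. [cite: GriffinEtAl2022, (2.6)] -/
theorem natDegree_gorttwJ_le (γ : ℕ → ℝ) (d n : ℕ) : (gorttwJ γ d n).natDegree ≤ d := by
  unfold gorttwJ
  refine (natDegree_C_mul_le _ _).trans (natDegree_comp_le.trans ?_)
  have hlin : (C (γ (n + d - 1) / γ (n + d)) * (C (gorttwDelta γ (n + d)) * X - 1) : ℝ[X]).natDegree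
      ≤ 1 := by
    rw [inner_eq, sub_eq_add_neg, ← C_neg]; exact natDegree_linear_le
  calc (jensenPoly γ d n).natDegree *
        (C (γ (n + d - 1) / γ (n + d)) * (C (gorttwDelta γ (n + d)) * X - 1)).natDegree
      ≤ d * 1 := Nat.mul_le_mul (natDegree_jensenPoly_le γ d n) hlin
    _ = d := mul_one d

/-- `J̃^{d,n}(X) = ∑_{k≤d} A_{d,k}(n) X^{d-k}`. [cite: GriffinEtAl2022, (2.6)] -/
theorem gorttwJ_eq_sum (γ : ℕ → ℝ) (d n : ℕ) :
    gorttwJ γ d n = ∑ k ∈ range (d + 1), C (gorttwA γ d n k) * X ^ (d - k) := by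
  have h := as_sum_range' (gorttwJ γ d n) (d + 1)
    (Nat.lt_succ_of_le (natDegree_gorttwJ_le γ d n))
  simp only [← C_mul_X_pow_eq_monomial] at h
  rw [← sum_range_reflect] at h
  refine h.trans (sum_congr rfl fun k hk => ?_)
  have hk' := mem_range.mp hk
  rw [gorttwA, show d + 1 - 1 - k = d - k from by omega]

/-- Raw coefficient formula: `[X^m] J̃^{d,n} = P · ∑_j (d choose j) γ(n+j) (j choose m) (aΔ)^m (-a)^{j-m}`
with `a = γ(n+d-1)/γ(n+d)`, `Δ = Δ(n+d)`, `P = γ(n+d)^{d-1}/(γ(n+d-1)^d Δ^d)`. [folklore] -/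
private lemma coeff_gorttwJ (γ : ℕ → ℝ) (d n m : ℕ) :
    (gorttwJ γ d n).coeff m =
      γ (n + d) ^ (d - 1) / (γ (n + d - 1) ^ d * gorttwDelta γ (n + d) ^ d) *
        ∑ j ∈ range (d + 1), (d.choose j : ℝ) * γ (n + j) *
          ((j.choose m : ℝ) * (γ (n + d - 1) / γ (n + d) * gorttwDelta γ (n + d)) ^ m *
            (-(γ (n + d - 1) / γ (n + d))) ^ (j - m)) := by
  unfold gorttwJ jensenPoly
  rw [inner_eq, coeff_C_mul, Polynomial.sum_comp, finsetSum_coeff]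
  congr 1
  refine sum_congr rfl fun j _ => ?_
  rw [mul_comp, C_comp, X_pow_comp, coeff_C_mul, coeff_C_mul_X_sub_C_pow]

/-! ### Lemma 2.2: `A_{d,0} = 1`, `A_{d,1} = 0`, `A_{d,2} = -d(d-1)` -/

variable (hγ : ∀ m, 0 < γ m)
include hγ

/-- `Δ(M) > 0` under strict log-concavity at `M`. [cite: GriffinEtAl2022, (2.3)] -/
theorem gorttwDelta_pos {M : ℕ} (hlc : γ (M - 2) * γ M < γ (M - 1) ^ 2) :
    0 < gorttwDelta γ M := by
  unfold gorttwDelta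
  apply Real.sqrt_pos.mpr
  have h1 : 0 < γ (M - 1) ^ 2 := pow_pos (hγ _) 2
  have : γ (M - 2) * γ M / γ (M - 1) ^ 2 < 1 := (div_lt_one h1).mpr hlc
  linarith

/-- `Δ(M)² = ½(1 - γ(M-2)γ(M)/γ(M-1)²)` under strict log-concavity at `M`.
[cite: GriffinEtAl2022, (2.3)] -/
theorem gorttwDelta_sq {M : ℕ} (hlc : γ (M - 2) * γ M < γ (M - 1) ^ 2) :
    gorttwDelta γ M ^ 2 = (1 - γ (M - 2) * γ M / γ (M - 1) ^ 2) / 2 := by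
  unfold gorttwDelta
  apply Real.sq_sqrt
  have h1 : 0 < γ (M - 1) ^ 2 := pow_pos (hγ _) 2
  have : γ (M - 2) * γ M / γ (M - 1) ^ 2 < 1 := (div_lt_one h1).mpr hlc
  linarith

/-- **Lemma 2.2, `A_{d,0}(n) = 1`** (`d ≥ 1`). [cite: GriffinEtAl2022, Lemma 2.2] -/
theorem gorttwA_zero (hd : 1 ≤ d) (hlc : γ (n + d - 2) * γ (n + d) < γ (n + d - 1) ^ 2) :
    gorttwA γ d n 0 = 1 := by
  have hΔ := (gorttwDelta_pos hγ hlc).ne'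
  obtain ⟨e, rfl⟩ : ∃ e, d = e + 1 := ⟨d - 1, by omega⟩
  have h0 := (hγ (n + (e + 1))).ne'
  have h1 := (hγ (n + e)).ne'
  rw [gorttwA, Nat.sub_zero, coeff_gorttwJ, sum_eq_single (e + 1)]
  · simp only [Nat.choose_self, Nat.cast_one, one_mul, Nat.sub_self, pow_zero, mul_one,
      Nat.add_sub_cancel, show n + (e + 1) - 1 = n + e from by omega] at hΔ ⊢
    rw [mul_pow, div_pow]
    field_simp
    ring
  · intro j hj hne
    have hj' : j < e + 1 := lt_of_le_of_ne (Nat.lt_succ_iff.mp (mem_range.mp hj)) hne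
    rw [Nat.choose_eq_zero_of_lt hj']; simp
  · intro h; exact absurd (self_mem_range_succ (e + 1)) h

/-- **Lemma 2.2, `A_{d,1}(n) = 0`** (`d ≥ 1`). [cite: GriffinEtAl2022, Lemma 2.2] -/
theorem gorttwA_one (hd : 1 ≤ d) (hlc : γ (n + d - 2) * γ (n + d) < γ (n + d - 1) ^ 2) :
    gorttwA γ d n 1 = 0 := by
  have hΔ := (gorttwDelta_pos hγ hlc).ne'
  obtain ⟨e, rfl⟩ : ∃ e, d = e + 1 := ⟨d - 1, by omega⟩
  have h0 := (hγ (n + (e + 1))).ne'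
  have h1 := (hγ (n + e)).ne'
  rw [gorttwA, coeff_gorttwJ, Nat.add_sub_cancel, sum_range_succ, sum_range_succ,
    sum_eq_zero (fun j hj => by
      rw [Nat.choose_eq_zero_of_lt (show j < e from mem_range.mp hj)]; simp)]
  simp only [zero_add, Nat.choose_self, Nat.choose_succ_self_right, Nat.cast_one, one_mul,
    Nat.sub_self, pow_zero, mul_one, Nat.add_sub_cancel_left, pow_one,
    show n + (e + 1) - 1 = n + e from by omega] at hΔ ⊢
  rw [mul_pow, div_pow]
  field_simp
  ring

/-- **Lemma 2.2, `A_{d,2}(n) = -d(d-1)`** (`d ≥ 2`; this is where `Δ(n+d)²` enters).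
[cite: GriffinEtAl2022, Lemma 2.2] -/
theorem gorttwA_two (hd : 2 ≤ d) (hlc : γ (n + d - 2) * γ (n + d) < γ (n + d - 1) ^ 2) :
    gorttwA γ d n 2 = -((d : ℝ) * ((d : ℝ) - 1)) := by
  have hΔ := (gorttwDelta_pos hγ hlc).ne'
  have hΔ2 := gorttwDelta_sq hγ hlc
  obtain ⟨e, rfl⟩ : ∃ e, d = e + 2 := ⟨d - 2, by omega⟩
  have c1 : (((e + 2).choose (e + 1) : ℕ) : ℝ) = (e : ℝ) + 2 := by
    rw [show e + 2 = (e + 1) + 1 from rfl, Nat.choose_succ_self_right]; push_cast; ring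
  have c2 : (((e + 2).choose e : ℕ) : ℝ) = ((e : ℝ) + 2) * ((e : ℝ) + 1) / 2 := by
    rw [Nat.choose_symm_of_eq_add (show e + 2 = e + 2 from rfl), Nat.cast_choose_two]
    push_cast; ring
  have c3 : (((e + 1).choose e : ℕ) : ℝ) = (e : ℝ) + 1 := by
    rw [Nat.choose_succ_self_right]; push_cast; ring
  rw [gorttwA, coeff_gorttwJ, Nat.add_sub_cancel, sum_range_succ, sum_range_succ, sum_range_succ,
    sum_eq_zero (fun j hj => by
      rw [Nat.choose_eq_zero_of_lt (show j < e from mem_range.mp hj)]; simp)]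
  simp only [zero_add, Nat.choose_self, Nat.cast_one, one_mul, Nat.sub_self, pow_zero, mul_one,
    Nat.add_sub_cancel_left, pow_one, c1, c2, c3,
    show n + (e + 2) = n + e + 2 from rfl, show n + (e + 1) = n + e + 1 from rfl,
    show n + e + 2 - 1 = n + e + 1 from by omega, Nat.add_sub_cancel,
    show e + 2 - 1 = e + 1 from rfl] at hΔ hΔ2 ⊢
  -- isolate `Δ²`: `Δ^{e+2} = Δ^e Δ²`, `(aΔ)^e = a^e Δ^e`, then substitute `Δ²`
  set Δ := gorttwDelta γ (n + e + 2) with hΔdef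
  rw [show Δ ^ (e + 2) = Δ ^ e * Δ ^ 2 from pow_add Δ e 2, mul_pow, div_pow]
  have hΔe : Δ ^ e ≠ 0 := pow_ne_zero e hΔ
  have hD0 : Δ ^ 2 ≠ 0 := pow_ne_zero 2 hΔ
  generalize hD : Δ ^ 2 = D at hΔ2 hD0 ⊢
  -- make the three values of `γ` opaque, then write `γ(n+e+1) = a · γ(n+e+2)`
  have hp0 := hγ (n + e + 2); have hp1 := hγ (n + e + 1); have hp2 := hγ (n + e)
  generalize hg0 : γ (n + e + 2) = g0 at hΔ2 hp0 ⊢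
  generalize hg1 : γ (n + e + 1) = g1 at hΔ2 hp1 ⊢
  generalize hg2 : γ (n + e) = g2 at hΔ2 hp2 ⊢
  have hg1' : g1 = g1 / g0 * g0 := (div_mul_cancel₀ g1 hp0.ne').symm
  generalize ha : g1 / g0 = a at hg1' ⊢
  subst hg1'
  have ha0 : a ≠ 0 := by
    rintro rfl; simp at hp1
  have hg0 : g0 ≠ 0 := hp0.ne'
  field_simp
  rw [hΔ2]
  field_simp
  push_cast
  ring

/-! ### From `J̃^{d,n}` back to `J^{d,n}`, and Lemma 2.4 as printed -/

/-- The first sentence of the proof of [GriffinEtAl2022, Lemma 2.4] ("there exist `A, B, C ∈ ℝ` …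
such that `J̃^{d,n}(X) = A J^{d,n}(BX + C)`"), in the inverse direction we use:
`J^{d,n}(X) = P⁻¹ · J̃^{d,n}(X/(aΔ) + 1/Δ)` with `a = γ(n+d-1)/γ(n+d)`, `Δ = Δ(n+d)`,
`P = γ(n+d)^{d-1}/(γ(n+d-1)^d Δ^d)` (`d ≥ 1`, `γ > 0`, strict log-concavity at `n + d`).
[cite: GriffinEtAl2022, Lemma 2.4 (proof, first sentence)] -/
theorem jensenPoly_eq_C_mul_gorttwJ_comp (hd : 1 ≤ d)
    (hlc : γ (n + d - 2) * γ (n + d) < γ (n + d - 1) ^ 2) :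
    jensenPoly γ d n =
      C (γ (n + d - 1) ^ d * gorttwDelta γ (n + d) ^ d / γ (n + d) ^ (d - 1)) *
        (gorttwJ γ d n).comp
          (C (γ (n + d) / (γ (n + d - 1) * gorttwDelta γ (n + d))) * X + C (gorttwDelta γ (n + d))⁻¹) := by
  have hΔ := (gorttwDelta_pos hγ hlc).ne'
  have h0 := (hγ (n + d)).ne'
  have h1 := (hγ (n + d - 1)).ne'
  set Δ := gorttwDelta γ (n + d)
  set g0 := γ (n + d)
  set g1 := γ (n + d - 1)
  -- the inner affine maps are inverse to each other
  have hlin : (C (g1 / g0) * (C Δ * X - 1)).comp (C (g0 / (g1 * Δ)) * X + C Δ⁻¹) = X := by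
    simp only [mul_comp, sub_comp, C_comp, X_comp, one_comp]
    have e1 : C (g1 / g0) * (C Δ * (C (g0 / (g1 * Δ)) * X + C Δ⁻¹) - 1) =
        C (g1 / g0 * Δ * (g0 / (g1 * Δ))) * X + C (g1 / g0 * (Δ * Δ⁻¹ - 1)) := by
      simp only [map_mul, map_sub, map_one]; ring
    rw [e1, show g1 / g0 * Δ * (g0 / (g1 * Δ)) = 1 from by field_simp,
      show g1 / g0 * (Δ * Δ⁻¹ - 1) = 0 from by rw [mul_inv_cancel₀ hΔ, sub_self, mul_zero],
      C_1, C_0, one_mul, add_zero]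
  unfold gorttwJ
  rw [mul_comp, C_comp, comp_assoc, hlin, comp_X, ← mul_assoc, ← C_mul]
  obtain ⟨e, rfl⟩ : ∃ e, d = e + 1 := ⟨d - 1, by omega⟩
  rw [Nat.add_sub_cancel, show g1 ^ (e + 1) * Δ ^ (e + 1) / g0 ^ e *
      (g0 ^ e / (g1 ^ (e + 1) * Δ ^ (e + 1))) = 1 from by field_simp, C_1, one_mul]

/-- **Lemma 2.4 of GORTTW, as printed, proved** [GriffinEtAl2022, Lemma 2.4]: for a positive sequence
`γ` with `γ(n+d-2)γ(n+d) < γ(n+d-1)²` (so that `Δ(n+d)` is real and nonzero; for `γ = ξ`'s Taylor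
coefficients this is Csordas–Norfolk–Varga's Turán inequality) and `d ≥ 2`, define `c_{d,n,j}`
by (2.7) from the `A_{d,k}(n)` of (2.6) (`monomialToHermite d (gorttwA γ d n) j`). *If
`∑_{j=3}^{d} 2^{-j} (d-j)!/(d-1)! · c_{d,n,j}² < 1`, then `J^{d,n}(X)` is hyperbolic* — indeed
`J^{d,n} = γ(n+d) ∏_{i<d} (X - sᵢ)` with `s₀ < s₁ < ⋯ < s_{d-1}` (real SIMPLE zeros).
[cite: GriffinEtAl2022, Lemma 2.4] -/
theorem jensenPoly_eq_prod_of_turanSum_lt_one (hd : 2 ≤ d)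
    (hlc : γ (n + d - 2) * γ (n + d) < γ (n + d - 1) ^ 2)
    (hT : turanSum d (monomialToHermite d (gorttwA γ d n)) < 1) :
    ∃ s : Fin d → ℝ, StrictMono s ∧ jensenPoly γ d n = C (γ (n + d)) * ∏ i, (X - C (s i)) := by
  have hΔp := gorttwDelta_pos hγ hlc
  have h0p := hγ (n + d)
  have h1p := hγ (n + d - 1)
  obtain ⟨t, ht, hprod⟩ := exists_eq_prod_of_turanSum_monomial_lt_one hd (gorttwA γ d n)
    (gorttwA_zero hγ (by omega) hlc) (gorttwA_two hγ hd hlc) hT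
  rw [← gorttwJ_eq_sum] at hprod
  rw [jensenPoly_eq_C_mul_gorttwJ_comp hγ (by omega) hlc, hprod, Polynomial.prod_comp]
  -- the zeros of `J^{d,n}` are `sᵢ = b⁻¹ (tᵢ - Δ⁻¹)`, `b = γ(n+d)/(γ(n+d-1)Δ) > 0`
  set Δ := gorttwDelta γ (n + d) with hΔdef
  set b := γ (n + d) / (γ (n + d - 1) * Δ) with hbdef
  have hb : 0 < b := div_pos h0p (mul_pos h1p hΔp)
  refine ⟨fun i => b⁻¹ * (t i - Δ⁻¹), fun i j hij => ?_, ?_⟩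
  · exact mul_lt_mul_of_pos_left (sub_lt_sub_right (ht hij) _) (inv_pos.mpr hb)
  have hfac : ∀ i : Fin d, (X - C (t i)).comp (C b * X + C Δ⁻¹) =
      C b * (X - C (b⁻¹ * (t i - Δ⁻¹))) := by
    intro i
    rw [sub_comp, X_comp, C_comp, mul_sub, ← C_mul,
      show b * (b⁻¹ * (t i - Δ⁻¹)) = t i - Δ⁻¹ from by rw [← mul_assoc, mul_inv_cancel₀ hb.ne', one_mul],
      C_sub]
    ring
  have hconst : γ (n + d - 1) ^ d * Δ ^ d / γ (n + d) ^ (d - 1) * b ^ d = γ (n + d) := by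
    rw [hbdef, div_pow, mul_pow]
    obtain ⟨e, rfl⟩ : ∃ e, d = e + 1 := ⟨d - 1, by omega⟩
    rw [Nat.add_sub_cancel]
    have := h0p.ne'; have := h1p.ne'; have := hΔp.ne'
    field_simp
    ring
  simp only [hfac, prod_mul_distrib, prod_const, card_univ, Fintype.card_fin]
  rw [← mul_assoc, ← C_pow, ← C_mul, hconst]

/-- **Lemma 2.4 of GORTTW, hyperbolicity form**: under the hypotheses of
`jensenPoly_eq_prod_of_turanSum_lt_one`, `J^{d,n}_γ` splits over `ℝ` ("is hyperbolic").
[cite: GriffinEtAl2022, Lemma 2.4] -/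
theorem jensenPoly_splits_of_turanSum_lt_one (hd : 2 ≤ d)
    (hlc : γ (n + d - 2) * γ (n + d) < γ (n + d - 1) ^ 2)
    (hT : turanSum d (monomialToHermite d (gorttwA γ d n)) < 1) :
    (jensenPoly γ d n).Splits := by
  obtain ⟨s, -, hs⟩ := jensenPoly_eq_prod_of_turanSum_lt_one hγ hd hlc hT
  rw [hs]
  exact (Splits.prod fun i _ => Splits.X_sub_C _).C_mul _

/-! ### The Turán quantity of Lemma 2.4 as a rational function of `γ(n), …, γ(n+d)`

Multiplying out (2.6): `A_{d,k}(n) = Δ(n+d)^{-k} · B_{d,k}(n)` with `B_{d,k}(n)` a rational function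
of the `γ`'s alone (`gorttwB`, `gorttwA_mul_gorttwDelta_pow`); by the parity built into the inversion
coefficients (2.7), `c_{d,n,j} = Δ(n+d)^{-j} · ĉ_j` with `ĉ_j` polynomial in `Δ(n+d)²` and the
`B_{d,k}(n)` (`monomialToHermite_gorttwA_mul_pow`), and `Δ(n+d)² = ½(1 − γ(n+d−2)γ(n+d)/γ(n+d−1)²)`
(`gorttwD`) is rational. Hence the left side of (2.8) is the rational function `gorttwTuranRat γ d n`
of `γ(n), …, γ(n+d)` (`turanSum_eq_gorttwTuranRat`) — no square root — which is the form in which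
an exact-rational / interval certificate evaluates the criterion
(`jensenPoly_eq_prod_of_gorttwTuranRat_lt_one`). -/

omit hγ in
/-- `Δ(M)²` written out: `½(1 − γ(M−2)γ(M)/γ(M−1)²)`. [cite: GriffinEtAl2022, (2.3)] -/
def gorttwD (γ : ℕ → ℝ) (M : ℕ) : ℝ := (1 - γ (M - 2) * γ M / γ (M - 1) ^ 2) / 2

omit hγ in
/-- `B_{d,k}(n) := Δ(n+d)^k · A_{d,k}(n)` in closed form, free of `Δ`: with `a = γ(n+d−1)/γ(n+d)`,
`B_{d,k}(n) = γ(n+d)^{d-1}/γ(n+d-1)^d · a^{d-k} · ∑_{j≤d} (d choose j)(j choose d-k) γ(n+j) (-a)^{j-(d-k)}`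
((2.6) multiplied out by the binomial theorem). [cite: GriffinEtAl2022, (2.6)] -/
def gorttwB (γ : ℕ → ℝ) (d n k : ℕ) : ℝ :=
  γ (n + d) ^ (d - 1) / γ (n + d - 1) ^ d * (γ (n + d - 1) / γ (n + d)) ^ (d - k) *
    ∑ j ∈ range (d + 1), (d.choose j : ℝ) * (j.choose (d - k) : ℝ) * γ (n + j) *
      (-(γ (n + d - 1) / γ (n + d))) ^ (j - (d - k))

omit hγ in
/-- The left-hand side of (2.8), `∑_{j=3}^{d} 2^{-j}(d-j)!/(d-1)! · c_{d,n,j}²`, as a rational function of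
`γ(n), …, γ(n+d)`: `c_{d,n,j}² = ĉ_j² / Δ(n+d)^{2j}` with
`ĉ_j = ∑_{k≤d} hermiteInvCoeff (d-k) (d-j) · (Δ(n+d)²)^{(j-k)/2} · B_{d,k}(n)`.
[cite: GriffinEtAl2022, (2.7)–(2.8)] -/
def gorttwTuranRat (γ : ℕ → ℝ) (d n : ℕ) : ℝ :=
  ∑ j ∈ Icc 3 d, ((d - j)! : ℝ) / (2 ^ j * ((d - 1)! : ℝ)) *
    (∑ k ∈ range (d + 1),
        hermiteInvCoeff (d - k) (d - j) * gorttwD γ (n + d) ^ ((j - k) / 2) * gorttwB γ d n k) ^ 2 /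
      gorttwD γ (n + d) ^ j

/-- `Δ(M)² = gorttwD γ M` under strict log-concavity at `M`. [cite: GriffinEtAl2022, (2.3)] -/
theorem gorttwDelta_sq_eq_gorttwD {M : ℕ} (hlc : γ (M - 2) * γ M < γ (M - 1) ^ 2) :
    gorttwDelta γ M ^ 2 = gorttwD γ M :=
  gorttwDelta_sq hγ hlc

/-- **`Δ(n+d)^k · A_{d,k}(n) = B_{d,k}(n)`** (`k ≤ d`): the coefficients of `J̃^{d,n}` carry exactly
the power `Δ^{-k}` of the uniformizer. [cite: GriffinEtAl2022, (2.6)] -/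
theorem gorttwA_mul_gorttwDelta_pow {k : ℕ} (hk : k ≤ d)
    (hlc : γ (n + d - 2) * γ (n + d) < γ (n + d - 1) ^ 2) :
    gorttwA γ d n k * gorttwDelta γ (n + d) ^ k = gorttwB γ d n k := by
  have hΔ : gorttwDelta γ (n + d) ≠ 0 := (gorttwDelta_pos hγ hlc).ne'
  unfold gorttwA gorttwB
  rw [coeff_gorttwJ]
  simp only [Finset.mul_sum, Finset.sum_mul]
  refine sum_congr rfl fun j _ => ?_
  have key : (gorttwDelta γ (n + d) ^ d)⁻¹ * (gorttwDelta γ (n + d) ^ (d - k) *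
      gorttwDelta γ (n + d) ^ k) = 1 := by
    rw [← pow_add, Nat.sub_add_cancel hk, inv_mul_cancel₀ (pow_ne_zero _ hΔ)]
  rw [mul_pow, div_eq_mul_inv _ (γ (n + d - 1) ^ d * gorttwDelta γ (n + d) ^ d), mul_inv]
  linear_combination γ (n + d) ^ (d - 1) * (γ (n + d - 1) ^ d)⁻¹ *
    (γ (n + d - 1) / γ (n + d)) ^ (d - k) * ((d.choose j : ℝ) * (j.choose (d - k) : ℝ) *
      γ (n + j) * (-(γ (n + d - 1) / γ (n + d))) ^ (j - (d - k))) * key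

/-- **`Δ(n+d)^j · c_{d,n,j} = ĉ_j`** (`j ≤ d`), `ĉ_j` as in `gorttwTuranRat`: by (2.7) only the
`A_{d,k}` with `k ≤ j`, `j − k` even enter `c_{d,n,j}`, and `Δ^{j} Δ^{-k} = (Δ²)^{(j-k)/2}`.
[cite: GriffinEtAl2022, (2.7)] -/
theorem monomialToHermite_gorttwA_mul_pow {j : ℕ} (hj : j ≤ d)
    (hlc : γ (n + d - 2) * γ (n + d) < γ (n + d - 1) ^ 2) :
    monomialToHermite d (gorttwA γ d n) j * gorttwDelta γ (n + d) ^ j =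
      ∑ k ∈ range (d + 1),
        hermiteInvCoeff (d - k) (d - j) * gorttwD γ (n + d) ^ ((j - k) / 2) * gorttwB γ d n k := by
  unfold monomialToHermite
  rw [Finset.sum_mul]
  refine sum_congr rfl fun k hk => ?_
  have hkd : k ≤ d := Nat.lt_succ_iff.mp (mem_range.mp hk)
  by_cases h0 : hermiteInvCoeff (d - k) (d - j) = 0
  · rw [h0]; ring
  · have hcond : d - j ≤ d - k ∧ Even (d - k - (d - j)) := by
      by_contra hc
      exact h0 (by unfold hermiteInvCoeff; rw [if_neg hc])
    obtain ⟨i, hi⟩ := hcond.2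
    have hjk : j = k + 2 * i := by omega
    have hi2 : (j - k) / 2 = i := by omega
    rw [hi2, ← gorttwA_mul_gorttwDelta_pow hγ hkd hlc, ← gorttwDelta_sq_eq_gorttwD hγ hlc, hjk,
      pow_add, ← pow_mul]
    ring

/-- **The Turán quantity of (2.8) is rational in `γ`**:
`∑_{j=3}^{d} 2^{-j}(d-j)!/(d-1)! · c_{d,n,j}² = gorttwTuranRat γ d n`. [cite: GriffinEtAl2022, (2.8)] -/
theorem turanSum_eq_gorttwTuranRat (hlc : γ (n + d - 2) * γ (n + d) < γ (n + d - 1) ^ 2) :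
    turanSum d (monomialToHermite d (gorttwA γ d n)) = gorttwTuranRat γ d n := by
  have hΔ : gorttwDelta γ (n + d) ≠ 0 := (gorttwDelta_pos hγ hlc).ne'
  unfold turanSum gorttwTuranRat
  refine sum_congr rfl fun j hj => ?_
  have hjd : j ≤ d := (mem_Icc.mp hj).2
  rw [← monomialToHermite_gorttwA_mul_pow hγ hjd hlc, ← gorttwDelta_sq_eq_gorttwD hγ hlc, ← pow_mul,
    mul_pow, ← pow_mul, mul_comm j 2, mul_div_assoc,
    mul_div_cancel_right₀ _ (pow_ne_zero _ hΔ)]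

/-- **Lemma 2.4 in certificate form**: if the rational function `gorttwTuranRat γ d n` of
`γ(n), …, γ(n+d)` is `< 1` (and `γ > 0`, `γ(n+d-2)γ(n+d) < γ(n+d-1)²`, `d ≥ 2`), then
`J^{d,n}_γ = γ(n+d) ∏_{i<d} (X - sᵢ)` with `s₀ < ⋯ < s_{d-1}`; in particular `J^{d,n}_γ` is
hyperbolic. [cite: GriffinEtAl2022, Lemma 2.4] -/
theorem jensenPoly_eq_prod_of_gorttwTuranRat_lt_one (hd : 2 ≤ d)
    (hlc : γ (n + d - 2) * γ (n + d) < γ (n + d - 1) ^ 2) (hT : gorttwTuranRat γ d n < 1) :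
    ∃ s : Fin d → ℝ, StrictMono s ∧ jensenPoly γ d n = C (γ (n + d)) * ∏ i, (X - C (s i)) :=
  jensenPoly_eq_prod_of_turanSum_lt_one hγ hd hlc ((turanSum_eq_gorttwTuranRat hγ hlc).symm ▸ hT)

end

end Literature.NumberTheory.LFunctions
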